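import Mathlib
import Literature.Analysis.PDE.ParabolicMaximumPrinciple1D
import Literature.Analysis.FluidPDE.SelfSimilarCollapseAnsatz
import Summits.NavierStokesRegularity.OSWSelfSimilar.HouLuoOriginLaws
import HarnessLib

/-!
# Viscous Hou–Luo profile MODEL: the θ-maximum-principle FLOOR `c_l ≥ 2c_ω` of the frozen-`ε` sheet,
# and the emptiness of its NS-type line

HONEST FRAMING (cell ns-blowup GROUP B «PROFILE SEARCH», zone Z3-b′ / Z3-b; human rulings D-0035/D-0074):
**1-D MODEL (the Hou–Luo boundary model with Laplacian dissipation added by the cell) and the printed 2-D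
Boussinesq profile system; one-variable calculus kernel-checked; not Euler, not Navier–Stokes;
«violates: none — MODEL».** Nothing in this file is a statement about Navier–Stokes.

OBJECT. The frozen-`ε` profile system of the viscous Hou–Luo model in the cell's gauge (profile-eng-3 g2
pre-registration (b′-0); `HouLuoOriginLaws.F1` / `.F2` in this directory; engines `z3hl.py` (eng-3 g3) and
`z5hl.py` (eng-5 g3/g4)): with `ω = C_ω Ω(ξ)`, `θ = C_θ Θ(ξ)`, `ξ = C_l x`, `C_θ C_l = C_ω²`,
`c_• = C_•′/C_•` (so `c_θ = 2c_ω − c_l`; blow-up of `ω` is `c_ω > 0`, the time gauge of record is `c_ω = 1`),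
the temperature profile `Θ` (whose `ξ`-derivative is the engines' unknown `P`) solves

  `(Θ-eq)   ε_θ Θ″ = c_θ Θ + (c_l ξ + a 𝒰) Θ′`,        `c_θ = 2 c_ω − c_l`,

(`FTheta` below; differentiating it once gives `F₂ ≡ 0` with `P = Θ′`, `theorem hasDerivAt_FTheta`), and the
vorticity profile solves `F₁ ≡ 0`:  `ε_ω Ω″ = c_ω Ω + (c_l ξ + a 𝒰) Ω′ − b (HΩ) Ω − P`  (Hou–Luo: `a = 1`,
`b = 0`; `b ≠ 0` is the gCLM/OSW stretching term, kept symbolic for contrast).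

WHAT IS KERNEL-CHECKED HERE (pure one-variable calculus; no existence statement, no Hilbert transform — `𝒰` and
`HΩ` are arbitrary functions, exactly as in `HouLuoOriginLaws`):
* `ctheta_mul_nonpos_of_isLocalMax` — at a local maximum `ξ*` of `Θ`, (Θ-eq) with `ε_θ ≥ 0` gives
  `c_θ · Θ(ξ*) = ε_θ Θ″(ξ*) ≤ 0`; hence `c_θ ≤ 0` at a positive maximum / negative minimum
  (`ctheta_nonpos_of_isLocalMax/Min`); at `ε_θ = 0`, `c_θ · Θ(ξ*) = 0` (`ctheta_mul_eq_zero_of_isLocalExtr`).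
* `theta_eq_zero_of_ctheta_pos` — **if `c_θ > 0` (i.e. `c_l < 2c_ω`) then every `C²` solution of (Θ-eq)
  with `Θ → 0` at `±∞` vanishes identically** (a decaying `Θ ≢ 0` has a positive max or a negative min).
* `comega_le_stretching_of_isLocalMax` — at a positive local maximum of `Ω` with `P ≡ 0`, `F₁ ≡ 0` gives
  `c_ω ≤ b · HΩ(ξ*)`: WITHOUT stretching (`b = 0`, Hou–Luo) a blowing-up (`c_ω > 0`) decaying vorticity profile
  needs `P ≢ 0` (`omega_eq_zero_of_noStretching`); WITH stretching (`b = 1`, gCLM/OSW) it is the necessary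
  condition `HΩ(ξ*) ≥ c_ω` — why the NS-type line E½ of the gCLM sheet (Z3-a) is populated and this one is not.
* `two_comega_le_cl` — **THE FLOOR**: a nontrivial decaying `C²` solution `(Ω, Θ)` of the viscous Hou–Luo
  profile system (`b = 0`, any `a`, any `ε_ω, ε_θ ≥ 0`, any `𝒰`, `HΩ`) with `c_ω > 0` has `2 c_ω ≤ c_l`;
  gauge `c_ω = 1`: `c_l ≥ 2` on the whole viscous sheet — consistent with the cell's measurements (CHH-connected
  family `c_l ∈ [2.7397954318, 3.0058594246]`, RULING (ar); `ε_θ = 0` sub-sheet decreasing to `2⁺`, SHEET §10.7;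
  HQWW's exact inviscid profiles `c_l ∈ (2, 4.53)`, `huangQinWangWei2025_selfSimilarHouLuo`; CHH `γ = (λ−2)/λ > 0`).
* `nsTypeLine_empty` — **the NS-type line is EMPTY for every family**: constant viscosity is self-consistent
  with the frozen sheet iff `c_l = c_ω/2` (gauge `c_ω = 1`: `c_l = ½`; tree `effectiveViscosity_half`), and at
  `(c_ω, c_l) = (1, ½)` — indeed at every `c_l < 2` (`trivial_of_cl_lt_two_comega`) — the only decaying `C²`
  solution is trivial. This turns the cell's standing caveat «other families at c_l = ½: Newton 348 seeds +
  time-marching 72 runs + degenerate-edge 90 seeds, NONE FOUND — never an exclusion» (RULING (ar) (3)) into an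
  EXCLUSION on `{c_l < 2}` under the printed hypotheses; «none found» remains the word for families with
  `c_l ≥ 2`. `effectiveViscosity_tendsto_atTop_on_sheet`: on every nontrivial decaying sheet point the
  constant-`ν` reading `ν_eff(t) = ν(T−t)^{1−2c_l}` DIVERGES (`c_l ≥ 2 > ½`) — the point solves exactly a
  model whose viscosity VANISHES like `(T−t)^{2c_l−1}` (SHEET §1.3 (ii)), never the constant-`ν` model.
* `BoussinesqThetaFloor.lam_eq_one_of_isLocalExtr` — the same mechanism in the printed 2-D Boussinesq profile
  system (WLGSB 2023 (1.3), tree `IsSelfSimilarBoussinesqProfile`, `θ`-equation `(1−λ)Θ + ((1+λ)y + U)·∇Θ = 0`):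
  an interior local extremum with `Θ(y*) ≠ 0` forces `λ = 1` (collapse exponent `γ = 1 + λ = 2`); so neither the
  printed unstable hierarchy `λ_n > 1` (`one_lt_boussinesqLambda`; `no_interior_extremum_on_hierarchy`) nor any
  profile at the NS-type scaling `γ = ½`, `λ = −½` (`no_interior_extremum_at_nsType_scaling`) has one.

PRINTED PARENT (presearch, cited not restated): D. Chae, *Nonexistence of self-similar singularities for the 3D
incompressible Euler equations*, Comm. Math. Phys. **273** (2007) 203–215 = arXiv:math/0601060, Thm 2.2 / Thm 2.4
[held text `paper:arxiv-math_0601060` pp. 5–6]: a scalar transported by a divergence-free field admits no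
self-similar blow-up `θ = Ψ(t)Θ(Φ(t)x)` with `Θ ∈ L^{p₁} ∩ L^{p₂}`, `p₁ < p₂` (conservation of every `L^p` norm
vs. the scaling of the ansatz), applied there to INVISCID 2-D Boussinesq. What is new here is only the viscous,
pointwise, profile-level version for the cell's MODEL sheet (diffusion turns Chae's conservation into the
one-sided `c_θ ≤ 0`) and the reading of the cell's Z3-b′ numbers; no novelty is claimed beyond that.
HYPOTHESES, PRINTED: `C²` as «`HasDerivAt Θ (Θ′ ξ) ξ`, `HasDerivAt Θ′ (Θ″ ξ) ξ` for all `ξ`» (resp. near the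
extremum), decay `Tendsto Θ (cocompact ℝ) (𝓝 0)` (automatic on the algebraic tail branch `Θ ~ |ξ|^{−c_θ/c_l}` when
`c_θ > 0`, but ASSUMED here), the equations pointwise on `ℝ`. NOT PROVED HERE: anything about profiles with
`c_l ≥ 2c_ω` (they exist: CHH/HQWW), anything dynamical (what the constant-`ν` Hou–Luo model does), anything about
Euler or Navier–Stokes. bears_on: LADDER-NS N5 / zones Z3-b′ (RULING (ar), SPEC v1.2 (r6-1)), Z3-b → N1; (M8).
-/

noncomputable section
open Set Filter Topology

namespace Summit.NavierStokesRegularity.OSWSelfSimilar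
namespace HouLuoViscousThetaFloor
open HouLuoOriginLaws (F1 F2)

/-! ### The temperature-profile equation and its relation to `F₂` -/

/-- The `Θ`-residual of the frozen-`ε` viscous Hou–Luo profile system as a function of `ξ`, with the profile
`Θ`, its first and second derivatives `dΘ`, `ddΘ` and the velocity `U = 𝒰` passed as functions:
`FΘ(ξ) = c_θ Θ(ξ) + (c_l ξ + a U(ξ)) Θ′(ξ) − ε Θ″(ξ)` (the rescaled transport–diffusion equation
`∂_τΘ + c_θΘ + (c_lξ + a𝒰)∂_ξΘ = ε∂_ξ²Θ` at a steady state; `c_θ = 2c_ω − c_l` in the Hou–Luo scaling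
`C_θ C_l = C_ω²`). [new here — MODEL bookkeeping] -/
def FTheta (cθ cl a ε : ℝ) (U Θ dΘ ddΘ : ℝ → ℝ) (ξ : ℝ) : ℝ :=
  cθ * Θ ξ + (cl * ξ + a * U ξ) * dΘ ξ - ε * ddΘ ξ

/-- `FΘ` is odd under `(Θ, Θ′, Θ″) ↦ (−Θ, −Θ′, −Θ″)` (the equation is linear in `Θ`). [new here — MODEL] -/
theorem FTheta_neg (cθ cl a ε : ℝ) (U Θ dΘ ddΘ : ℝ → ℝ) (ξ : ℝ) :
    FTheta cθ cl a ε U (fun x => -Θ x) (fun x => -dΘ x) (fun x => -ddΘ x) ξ =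
      -FTheta cθ cl a ε U Θ dΘ ddΘ ξ := by
  unfold FTheta; ring

/-- **Differentiating the `Θ`-equation gives `F₂`.** If `Θ′ = P`, `P′ = dP`, `dP′ = ddP` (as `HasDerivAt` facts at
`ξ`; only `Θ′, P′, dP′` are needed), `𝒰′(ξ) = HΩ(ξ)` and `c_θ = 2c_ω − c_l`, then `FΘ` has derivative `F₂(ξ)` at `ξ`
(`(c_θ + c_l + aHΩ)P + (c_lξ + a𝒰)P′ − εP″ = (2c_ω + aHΩ)P + …`): the engines' `F₂ ≡ 0` is the `ξ`-derivative of
the temperature equation used here. [new here — MODEL] -/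
theorem hasDerivAt_FTheta (cω cl a ε : ℝ) (H U Θ P dP ddP : ℝ → ℝ) (ξ : ℝ)
    (hΘ : HasDerivAt Θ (P ξ) ξ) (hP : HasDerivAt P (dP ξ) ξ) (hdP : HasDerivAt dP (ddP ξ) ξ)
    (hU : HasDerivAt U (H ξ) ξ) :
    HasDerivAt (FTheta (2 * cω - cl) cl a ε U Θ P dP) (F2 cω cl a ε H U P dP ddP ξ) ξ := by
  have h1 : HasDerivAt (fun x => (2 * cω - cl) * Θ x) ((2 * cω - cl) * P ξ) ξ := hΘ.const_mul _
  have h2 : HasDerivAt (fun x => cl * x + a * U x) (cl * 1 + a * H ξ) ξ :=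
    ((hasDerivAt_id' ξ).const_mul cl).add (hU.const_mul a)
  have h3 : HasDerivAt (fun x => (cl * x + a * U x) * P x)
      ((cl * 1 + a * H ξ) * P ξ + (cl * ξ + a * U ξ) * dP ξ) ξ := h2.mul hP
  have h4 : HasDerivAt (fun x => ε * dP x) (ε * ddP ξ) ξ := hdP.const_mul ε
  have h := (h1.add h3).sub h4
  have hfun : FTheta (2 * cω - cl) cl a ε U Θ P dP =
      fun x => (2 * cω - cl) * Θ x + (cl * x + a * U x) * P x - ε * dP x := by
    funext x; rfl
  rw [hfun]
  refine h.congr_deriv ?_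
  unfold F2
  ring

/-! ### The maximum principle at an extremum of `Θ` -/

/-- **At a local maximum of `Θ`: `c_θ Θ(ξ*) ≤ 0`.** If `FΘ(ξ*) = 0` with `ε ≥ 0`, `Θ` is differentiable near
`ξ*` with derivative `dΘ`, `dΘ` has derivative `ddΘ(ξ*)` at `ξ*`, and `ξ*` is a local maximum of `Θ`, then
`Θ′(ξ*) = 0` and `Θ″(ξ*) ≤ 0`, so `c_θ Θ(ξ*) = εΘ″(ξ*) ≤ 0`. [new here — MODEL; second-order condition from
the tree's `Literature.Analysis.PDE.deriv_deriv_nonpos_of_isLocalMax`] -/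
theorem ctheta_mul_nonpos_of_isLocalMax (cθ cl a ε : ℝ) (U Θ dΘ ddΘ : ℝ → ℝ) (ξ : ℝ) (hε : 0 ≤ ε)
    (hF : FTheta cθ cl a ε U Θ dΘ ddΘ ξ = 0) (hmax : IsLocalMax Θ ξ)
    (hΘ : ∀ᶠ x in 𝓝 ξ, HasDerivAt Θ (dΘ x) x) (hdΘ : HasDerivAt dΘ (ddΘ ξ) ξ) :
    cθ * Θ ξ ≤ 0 := by
  have hd0 : dΘ ξ = 0 := hmax.hasDerivAt_eq_zero hΘ.self_of_nhds
  have hdd : ddΘ ξ ≤ 0 := Literature.Analysis.PDE.deriv_deriv_nonpos_of_isLocalMax hmax hΘ hdΘ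
  have hE : cθ * Θ ξ = ε * ddΘ ξ := by
    unfold FTheta at hF
    rw [hd0] at hF
    linarith
  rw [hE]
  exact mul_nonpos_of_nonneg_of_nonpos hε hdd

/-- **Positive local maximum ⇒ `c_θ ≤ 0`.** [new here — MODEL] -/
theorem ctheta_nonpos_of_isLocalMax (cθ cl a ε : ℝ) (U Θ dΘ ddΘ : ℝ → ℝ) (ξ : ℝ) (hε : 0 ≤ ε)
    (hF : FTheta cθ cl a ε U Θ dΘ ddΘ ξ = 0) (hmax : IsLocalMax Θ ξ) (hpos : 0 < Θ ξ)
    (hΘ : ∀ᶠ x in 𝓝 ξ, HasDerivAt Θ (dΘ x) x) (hdΘ : HasDerivAt dΘ (ddΘ ξ) ξ) : cθ ≤ 0 := by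
  have h := ctheta_mul_nonpos_of_isLocalMax cθ cl a ε U Θ dΘ ddΘ ξ hε hF hmax hΘ hdΘ
  by_contra hc
  push Not at hc
  have : 0 < cθ * Θ ξ := mul_pos hc hpos
  linarith

/-- **Negative local minimum ⇒ `c_θ ≤ 0`** (apply the previous lemma to `−Θ`). [new here — MODEL] -/
theorem ctheta_nonpos_of_isLocalMin (cθ cl a ε : ℝ) (U Θ dΘ ddΘ : ℝ → ℝ) (ξ : ℝ) (hε : 0 ≤ ε)
    (hF : FTheta cθ cl a ε U Θ dΘ ddΘ ξ = 0) (hmin : IsLocalMin Θ ξ) (hneg : Θ ξ < 0)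
    (hΘ : ∀ᶠ x in 𝓝 ξ, HasDerivAt Θ (dΘ x) x) (hdΘ : HasDerivAt dΘ (ddΘ ξ) ξ) : cθ ≤ 0 := by
  have hF' : FTheta cθ cl a ε U (fun x => -Θ x) (fun x => -dΘ x) (fun x => -ddΘ x) ξ = 0 := by
    rw [FTheta_neg, hF, neg_zero]
  have hmax : IsLocalMax (fun x => -Θ x) ξ := hmin.neg
  have hΘ' : ∀ᶠ x in 𝓝 ξ, HasDerivAt (fun x => -Θ x) (-dΘ x) x := hΘ.mono fun x hx => hx.neg
  have hdΘ' : HasDerivAt (fun x => -dΘ x) (-ddΘ ξ) ξ := hdΘ.neg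
  exact ctheta_nonpos_of_isLocalMax cθ cl a ε U (fun x => -Θ x) (fun x => -dΘ x) (fun x => -ddΘ x) ξ hε
    hF' hmax (by linarith) hΘ' hdΘ'

/-- **Inviscid case (`ε = 0`): at every local extremum `c_θ Θ(ξ*) = 0`** (transport alone: Chae's conservation
statement read at the profile level — a nonzero extremal value forces `c_θ = 0`, i.e. `c_l = 2c_ω` exactly).
[new here — MODEL] -/
theorem ctheta_mul_eq_zero_of_isLocalExtr (cθ cl a : ℝ) (U Θ dΘ ddΘ : ℝ → ℝ) (ξ : ℝ)
    (hF : FTheta cθ cl a 0 U Θ dΘ ddΘ ξ = 0) (hext : IsLocalExtr Θ ξ) (hΘ : HasDerivAt Θ (dΘ ξ) ξ) :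
    cθ * Θ ξ = 0 := by
  have hd0 : dΘ ξ = 0 := hext.hasDerivAt_eq_zero hΘ
  unfold FTheta at hF
  rw [hd0] at hF
  linarith

/-! ### Decaying profiles: `c_θ > 0` forces `Θ ≡ 0` -/

/-- A continuous real function on `ℝ` tending to `0` at `±∞` with a positive value attains a global (hence
local) maximum, at which it is positive. [folklore] -/
theorem exists_isLocalMax_pos_of_tendsto_zero {f : ℝ → ℝ} (hf : Continuous f)
    (h0 : Tendsto f (cocompact ℝ) (𝓝 0)) {x₀ : ℝ} (hx₀ : 0 < f x₀) :
    ∃ x, IsLocalMax f x ∧ 0 < f x := by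
  have hev : ∀ᶠ x in cocompact ℝ, f x ≤ f x₀ :=
    (h0.eventually (gt_mem_nhds hx₀)).mono fun x hx => hx.le
  obtain ⟨x, hx⟩ := hf.exists_forall_ge' x₀ hev
  refine ⟨x, Filter.Eventually.of_forall fun y => hx y, lt_of_lt_of_le hx₀ (hx x₀)⟩

/-- A continuous real function on `ℝ` tending to `0` at `±∞` with a negative value attains a local minimum at
which it is negative. [folklore] -/
theorem exists_isLocalMin_neg_of_tendsto_zero {f : ℝ → ℝ} (hf : Continuous f)
    (h0 : Tendsto f (cocompact ℝ) (𝓝 0)) {x₀ : ℝ} (hx₀ : f x₀ < 0) :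
    ∃ x, IsLocalMin f x ∧ f x < 0 := by
  have hf' : Continuous fun x => -f x := hf.neg
  have h0' : Tendsto (fun x => -f x) (cocompact ℝ) (𝓝 0) := by simpa using h0.neg
  obtain ⟨x, hmax, hpos⟩ := exists_isLocalMax_pos_of_tendsto_zero hf' h0' (x₀ := x₀) (by linarith)
  refine ⟨x, ?_, by linarith⟩
  have := hmax.neg
  simpa using this

/-- **`c_θ > 0` ⇒ `Θ ≡ 0` for decaying profiles.** If `Θ` is `C²` on `ℝ` (`Θ′ = dΘ`, `Θ″ = ddΘ` everywhere), solves
the `Θ`-equation `FΘ ≡ 0` with `ε ≥ 0` and SOME drift `𝒰`, tends to `0` at `±∞`, and `c_θ > 0`, then `Θ = 0`: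
a nontrivial decaying `Θ` has a positive maximum or a negative minimum, where `c_θ Θ = εΘ″` has the wrong sign.
In the Hou–Luo scaling `c_θ = 2c_ω − c_l`, so this is the statement «no temperature profile below the floor
`c_l = 2c_ω`». [new here — MODEL; printed parent Chae 2007 CMP 273 Thm 2.2 (inviscid, `L^{p₁} ∩ L^{p₂}`)] -/
theorem theta_eq_zero_of_ctheta_pos (cθ cl a ε : ℝ) (U Θ dΘ ddΘ : ℝ → ℝ) (hε : 0 ≤ ε) (hcθ : 0 < cθ)
    (hF : ∀ ξ, FTheta cθ cl a ε U Θ dΘ ddΘ ξ = 0) (hΘ : ∀ x, HasDerivAt Θ (dΘ x) x)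
    (hdΘ : ∀ x, HasDerivAt dΘ (ddΘ x) x) (h0 : Tendsto Θ (cocompact ℝ) (𝓝 0)) : Θ = 0 := by
  have hcont : Continuous Θ := continuous_iff_continuousAt.2 fun x => (hΘ x).continuousAt
  funext x₀
  by_contra hne
  rcases lt_or_gt_of_ne hne with hneg | hpos
  · obtain ⟨x, hmin, hx⟩ := exists_isLocalMin_neg_of_tendsto_zero hcont h0 hneg
    have := ctheta_nonpos_of_isLocalMin cθ cl a ε U Θ dΘ ddΘ x hε (hF x) hmin hx
      (Filter.Eventually.of_forall hΘ) (hdΘ x)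
    linarith
  · have hpos' : 0 < Θ x₀ := by simpa using hpos
    obtain ⟨x, hmax, hx⟩ := exists_isLocalMax_pos_of_tendsto_zero hcont h0 hpos'
    have := ctheta_nonpos_of_isLocalMax cθ cl a ε U Θ dΘ ddΘ x hε (hF x) hmax hx
      (Filter.Eventually.of_forall hΘ) (hdΘ x)
    linarith

/-! ### The vorticity equation without forcing: stretching vs. no stretching -/

/-- **At a positive local maximum of `Ω` with `P ≡ 0`: `c_ω ≤ b·HΩ(ξ*)`.** From `F₁(ξ*) = 0`
(`ε_ω Ω″ = c_ω Ω + (c_l ξ + a𝒰)Ω′ − b(HΩ)Ω − P`) with `P(ξ*) = 0`, `ε ≥ 0`, `Ω′(ξ*) = 0`, `Ω″(ξ*) ≤ 0`: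
`(c_ω − b HΩ(ξ*)) Ω(ξ*) ≤ 0`. For the Hou–Luo model (`b = 0`) this says a blowing-up (`c_ω > 0`) vorticity
profile cannot have a positive maximum where the temperature forcing vanishes; for gCLM/OSW (`b = 1`) it is the
necessary condition «stretching `HΩ ≥ c_ω` at the vorticity maximum» met by the populated NS-type line E½ of
SHEET-ℝ. [new here — MODEL] -/
theorem comega_le_stretching_of_isLocalMax (cω cl a b ε : ℝ) (H U Om dOm ddOm P : ℝ → ℝ) (ξ : ℝ)
    (hε : 0 ≤ ε) (hF : F1 cω cl a b ε H U Om dOm ddOm P ξ = 0) (hP : P ξ = 0) (hmax : IsLocalMax Om ξ)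
    (hpos : 0 < Om ξ) (hOm : ∀ᶠ x in 𝓝 ξ, HasDerivAt Om (dOm x) x) (hdOm : HasDerivAt dOm (ddOm ξ) ξ) :
    cω ≤ b * H ξ := by
  have hd0 : dOm ξ = 0 := hmax.hasDerivAt_eq_zero hOm.self_of_nhds
  have hdd : ddOm ξ ≤ 0 := Literature.Analysis.PDE.deriv_deriv_nonpos_of_isLocalMax hmax hOm hdOm
  have hE : (cω - b * H ξ) * Om ξ = ε * ddOm ξ := by
    unfold HouLuoOriginLaws.F1 at hF
    rw [hd0, hP] at hF
    linarith
  have hle : (cω - b * H ξ) * Om ξ ≤ 0 := by rw [hE]; exact mul_nonpos_of_nonneg_of_nonpos hε hdd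
  by_contra hc
  push Not at hc
  have : 0 < (cω - b * H ξ) * Om ξ := mul_pos (by linarith) hpos
  linarith

/-- **No stretching, no forcing ⇒ no blowing-up vorticity profile.** For the Hou–Luo vorticity equation
(`b = 0`) with `P ≡ 0`, `c_ω > 0`, `ε ≥ 0`, a `C²` solution `Ω` of `F₁ ≡ 0` tending to `0` at `±∞` vanishes
identically (apply the previous lemma to `Ω` and to `−Ω`, which solves the same linear equation).
[new here — MODEL] -/
theorem omega_eq_zero_of_noStretching (cω cl a ε : ℝ) (H U Om dOm ddOm : ℝ → ℝ) (hε : 0 ≤ ε) (hcω : 0 < cω)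
    (hF : ∀ ξ, F1 cω cl a 0 ε H U Om dOm ddOm (fun _ => 0) ξ = 0) (hOm : ∀ x, HasDerivAt Om (dOm x) x)
    (hdOm : ∀ x, HasDerivAt dOm (ddOm x) x) (h0 : Tendsto Om (cocompact ℝ) (𝓝 0)) : Om = 0 := by
  -- `F₁` with `b = 0`, `P = 0` is `FΘ` with `c_θ := c_ω`
  have hF' : ∀ ξ, FTheta cω cl a ε U Om dOm ddOm ξ = 0 := by
    intro ξ
    have h := hF ξ
    unfold HouLuoOriginLaws.F1 at h
    unfold FTheta
    linarith
  exact theta_eq_zero_of_ctheta_pos cω cl a ε U Om dOm ddOm hε hcω hF' hOm hdOm h0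

/-! ### The floor and the NS-type line -/

/-- **THE FLOOR `2c_ω ≤ c_l` OF THE VISCOUS HOU–LUO SHEET.** Let `(Ω, Θ)` be `C²` on `ℝ`
(`Ω′ = dOm`, `Ω″ = ddOm`, `Θ′ = P`, `Θ″ = dP` everywhere), both tending to `0` at `±∞`, solving the frozen-`ε`
viscous Hou–Luo profile system with SOME functions `𝒰`, `HΩ`: `F₁ ≡ 0` with `b = 0` and temperature forcing
`P = Θ′`, and the `Θ`-equation `FΘ ≡ 0` with `c_θ = 2c_ω − c_l`; viscosities `ε_ω, ε_θ ≥ 0`; blow-up gauge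
`c_ω > 0`. If the point is nontrivial (`Θ ≢ 0` or `Ω ≢ 0`) then `2 c_ω ≤ c_l` — in the time gauge `c_ω = 1`,
`c_l ≥ 2`. [new here — MODEL; hypotheses as printed in the module docstring] -/
theorem two_comega_le_cl (cω cl a εω εθ : ℝ) (H U Om dOm ddOm Θ P dP : ℝ → ℝ) (hεω : 0 ≤ εω) (hεθ : 0 ≤ εθ)
    (hcω : 0 < cω) (hF1 : ∀ ξ, F1 cω cl a 0 εω H U Om dOm ddOm P ξ = 0)
    (hFΘ : ∀ ξ, FTheta (2 * cω - cl) cl a εθ U Θ P dP ξ = 0)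
    (hOm : ∀ x, HasDerivAt Om (dOm x) x) (hdOm : ∀ x, HasDerivAt dOm (ddOm x) x)
    (hΘ : ∀ x, HasDerivAt Θ (P x) x) (hP : ∀ x, HasDerivAt P (dP x) x)
    (hOm0 : Tendsto Om (cocompact ℝ) (𝓝 0)) (hΘ0 : Tendsto Θ (cocompact ℝ) (𝓝 0))
    (hnontrivial : Θ ≠ 0 ∨ Om ≠ 0) : 2 * cω ≤ cl := by
  by_contra hlt
  push Not at hlt
  have hcθ : 0 < 2 * cω - cl := by linarith
  have hΘz : Θ = 0 := theta_eq_zero_of_ctheta_pos (2 * cω - cl) cl a εθ U Θ P dP hεθ hcθ hFΘ hΘ hP hΘ0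
  -- `Θ ≡ 0` forces `P = Θ′ ≡ 0`
  have hPz : ∀ x, P x = 0 := by
    intro x
    have h1 : HasDerivAt Θ (P x) x := hΘ x
    rw [hΘz] at h1
    have h2 : HasDerivAt (0 : ℝ → ℝ) 0 x := hasDerivAt_const x 0
    exact h1.unique h2
  have hF1' : ∀ ξ, F1 cω cl a 0 εω H U Om dOm ddOm (fun _ => 0) ξ = 0 := by
    intro ξ
    have h := hF1 ξ
    unfold HouLuoOriginLaws.F1 at h ⊢
    rw [hPz ξ] at h
    linarith
  have hOmz : Om = 0 := omega_eq_zero_of_noStretching cω cl a εω H U Om dOm ddOm hεω hcω hF1' hOm hdOm hOm0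
  rcases hnontrivial with h | h
  · exact h hΘz
  · exact h hOmz

/-- **Below the floor the sheet is empty**: same hypotheses with `c_l < 2c_ω` ⇒ `Θ ≡ 0` and `Ω ≡ 0`.
[new here — MODEL] -/
theorem trivial_of_cl_lt_two_comega (cω cl a εω εθ : ℝ) (H U Om dOm ddOm Θ P dP : ℝ → ℝ) (hεω : 0 ≤ εω)
    (hεθ : 0 ≤ εθ) (hcω : 0 < cω) (hcl : cl < 2 * cω)
    (hF1 : ∀ ξ, F1 cω cl a 0 εω H U Om dOm ddOm P ξ = 0)
    (hFΘ : ∀ ξ, FTheta (2 * cω - cl) cl a εθ U Θ P dP ξ = 0)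
    (hOm : ∀ x, HasDerivAt Om (dOm x) x) (hdOm : ∀ x, HasDerivAt dOm (ddOm x) x)
    (hΘ : ∀ x, HasDerivAt Θ (P x) x) (hP : ∀ x, HasDerivAt P (dP x) x)
    (hOm0 : Tendsto Om (cocompact ℝ) (𝓝 0)) (hΘ0 : Tendsto Θ (cocompact ℝ) (𝓝 0)) : Θ = 0 ∧ Om = 0 := by
  by_contra hne
  have hnt : Θ ≠ 0 ∨ Om ≠ 0 := by
    by_contra hboth
    push Not at hboth
    exact hne ⟨hboth.1, hboth.2⟩
  have := two_comega_le_cl cω cl a εω εθ H U Om dOm ddOm Θ P dP hεω hεθ hcω hF1 hFΘ hOm hdOm hΘ hP hOm0 hΘ0 hnt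
  linarith

/-- **THE NS-TYPE LINE OF THE VISCOUS HOU–LUO SHEET IS EMPTY (every family).** In the gauge of record
`c_ω = 1`, constant physical viscosity is self-consistent with a frozen-`ε` sheet point iff `c_l = ½`
(`Literature.Analysis.FluidPDE.effectiveViscosity_half`: `ν_eff(t) = ν(T−t)^{1−2c_l}` is constant exactly at
`c_l = ½`); at `(c_ω, c_l) = (1, ½)` the only `C²` decaying solution of the viscous Hou–Luo profile system — any
`ε_ω, ε_θ ≥ 0`, any drift `𝒰`, any `HΩ`, any advection knob `a` — is the trivial one. MODEL statement; the
cell's three probes at `c_l = ½` (Newton 348 seeds, time-marching 72 runs, degenerate-edge 90 seeds: none found)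
are superseded on `{c_l < 2}` by this exclusion under the printed hypotheses. [new here — MODEL] -/
theorem nsTypeLine_empty (a εω εθ : ℝ) (H U Om dOm ddOm Θ P dP : ℝ → ℝ) (hεω : 0 ≤ εω) (hεθ : 0 ≤ εθ)
    (hF1 : ∀ ξ, F1 1 (1 / 2) a 0 εω H U Om dOm ddOm P ξ = 0)
    (hFΘ : ∀ ξ, FTheta (2 * 1 - 1 / 2) (1 / 2) a εθ U Θ P dP ξ = 0)
    (hOm : ∀ x, HasDerivAt Om (dOm x) x) (hdOm : ∀ x, HasDerivAt dOm (ddOm x) x)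
    (hΘ : ∀ x, HasDerivAt Θ (P x) x) (hP : ∀ x, HasDerivAt P (dP x) x)
    (hOm0 : Tendsto Om (cocompact ℝ) (𝓝 0)) (hΘ0 : Tendsto Θ (cocompact ℝ) (𝓝 0)) : Θ = 0 ∧ Om = 0 :=
  trivial_of_cl_lt_two_comega 1 (1 / 2) a εω εθ H U Om dOm ddOm Θ P dP hεω hεθ one_pos (by norm_num)
    hF1 hFΘ hOm hdOm hΘ hP hOm0 hΘ0

/-- **The physical-viscosity reading of every nontrivial sheet point diverges.** Under the hypotheses of
`two_comega_le_cl` in the gauge `c_ω = 1`, the exponent satisfies `c_l ≥ 2 > ½`, so for every `ν > 0` the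
effective viscosity `ν_eff(t) = ν (T−t)^{1−2c_l}` of the constant-`ν` model in these similarity variables tends
to `+∞` as `t ↑ T` (`Literature.Analysis.FluidPDE.tendsto_effectiveViscosity_atTop_of_half_lt`): a frozen sheet
point is never a constant-`ν` object (equivalently, the model it solves exactly has viscosity
`ε(T−t)^{2c_l−1} → 0`, SHEET §1.3 (ii)). [new here — MODEL] -/
theorem effectiveViscosity_tendsto_atTop_on_sheet (cl a εω εθ : ℝ) (H U Om dOm ddOm Θ P dP : ℝ → ℝ)
    (hεω : 0 ≤ εω) (hεθ : 0 ≤ εθ) (hF1 : ∀ ξ, F1 1 cl a 0 εω H U Om dOm ddOm P ξ = 0)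
    (hFΘ : ∀ ξ, FTheta (2 * 1 - cl) cl a εθ U Θ P dP ξ = 0)
    (hOm : ∀ x, HasDerivAt Om (dOm x) x) (hdOm : ∀ x, HasDerivAt dOm (ddOm x) x)
    (hΘ : ∀ x, HasDerivAt Θ (P x) x) (hP : ∀ x, HasDerivAt P (dP x) x)
    (hOm0 : Tendsto Om (cocompact ℝ) (𝓝 0)) (hΘ0 : Tendsto Θ (cocompact ℝ) (𝓝 0))
    (hnontrivial : Θ ≠ 0 ∨ Om ≠ 0) {ν : ℝ} (hν : 0 < ν) (T : ℝ) :
    2 ≤ cl ∧ Tendsto (Literature.Analysis.FluidPDE.effectiveViscosity ν cl T) (𝓝[<] T) atTop := by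
  have h2 : 2 * (1 : ℝ) ≤ cl :=
    two_comega_le_cl 1 cl a εω εθ H U Om dOm ddOm Θ P dP hεω hεθ one_pos hF1 hFΘ hOm hdOm hΘ hP hOm0 hΘ0
      hnontrivial
  refine ⟨by linarith, ?_⟩
  exact Literature.Analysis.FluidPDE.tendsto_effectiveViscosity_atTop_of_half_lt (by linarith) hν

end HouLuoViscousThetaFloor

/-! ### The same mechanism in the printed 2-D Boussinesq profile system (Z3-b) -/

namespace BoussinesqThetaFloor

open Literature.Analysis.FluidPDE

/-- **2-D Boussinesq (Wang–Lai–Gómez-Serrano–Buckmaster 2023 (1.3)): an interior local extremum of the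
temperature profile with `Θ(y*) ≠ 0` forces `λ = 1`** (collapse exponent `γ = 1 + λ = 2`, the same floor): the
printed `θ`-equation `(1−λ)Θ + ((1+λ)y + U)·∇Θ = 0` at `y*`, where `DΘ(y*) = 0`. MODEL / printed-profile-system
statement; nothing about existence. [cite: WangLaiGomezSerranoBuckmaster2023, §1.1 eq. (1.3)] -/
theorem lam_eq_one_of_isLocalExtr {lam : ℝ} {U : EuclideanSpace ℝ (Fin 2) → EuclideanSpace ℝ (Fin 2)}
    {Θ P : EuclideanSpace ℝ (Fin 2) → ℝ} (h : IsSelfSimilarBoussinesqProfile lam U Θ P)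
    {y : EuclideanSpace ℝ (Fin 2)} (hy : y ∈ wlgsbHalfPlane) (hext : IsLocalExtr Θ y) (hΘ : Θ y ≠ 0) :
    lam = 1 := by
  have hfd : fderiv ℝ Θ y = 0 := hext.fderiv_eq_zero
  have heq : (1 - lam) * Θ y = 0 := by simpa [hfd] using h.temperature y hy
  have : 1 - lam = 0 := by
    rcases mul_eq_zero.mp heq with h1 | h1
    · exact h1
    · exact absurd h1 hΘ
  linarith

/-- **On the printed Boussinesq/Euler hierarchy `λ_n` (Wang et al. 2025; tree `wangEtAl2025_boussinesqLambda`,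
`one_lt_boussinesqLambda`: `λ_n > 1`) a profile's temperature has NO interior local extremum off its zero
set** — the hierarchy lies strictly above the floor `λ = 1` and accumulates at it (`λ_n ↓ 1⁺`). [cite: WangEtAl2025, main text (empirical rule λ_n ∼ 1/(1.4187n + 1.0863) + 1)] -/
theorem no_interior_extremum_on_hierarchy (n : ℕ) {U : EuclideanSpace ℝ (Fin 2) → EuclideanSpace ℝ (Fin 2)}
    {Θ P : EuclideanSpace ℝ (Fin 2) → ℝ} (h : IsSelfSimilarBoussinesqProfile (wangEtAl2025_boussinesqLambda n) U Θ P)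
    {y : EuclideanSpace ℝ (Fin 2)} (hy : y ∈ wlgsbHalfPlane) (hext : IsLocalExtr Θ y) : Θ y = 0 := by
  by_contra hne
  have h1 := lam_eq_one_of_isLocalExtr h hy hext hne
  have h2 := one_lt_boussinesqLambda n
  rw [h1] at h2
  exact lt_irrefl _ h2

/-- **At the NS-type scaling no Boussinesq profile has an interior temperature extremum off its zero set.**
Constant viscosity is self-consistent only at the collapse exponent `γ = ½` (`effectiveViscosity_half`), i.e.
`λ = γ − 1 = −½` in the WLGSB convention (`collapseExponent_wlgsb`), and `−½ ≠ 1`. (A decaying continuous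
`Θ ≢ 0` on the closed half plane vanishing on the wall would have such an extremum; that topological step is not
taken here.) [cite: WangLaiGomezSerranoBuckmaster2023, §1.1 eq. (1.3)] -/
theorem no_interior_extremum_at_nsType_scaling {U : EuclideanSpace ℝ (Fin 2) → EuclideanSpace ℝ (Fin 2)}
    {Θ P : EuclideanSpace ℝ (Fin 2) → ℝ} (h : IsSelfSimilarBoussinesqProfile (-1 / 2) U Θ P)
    {y : EuclideanSpace ℝ (Fin 2)} (hy : y ∈ wlgsbHalfPlane) (hext : IsLocalExtr Θ y) :
    Θ y = 0 ∧ collapseExponent_wlgsb (-1 / 2) = 1 / 2 := by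
  refine ⟨?_, by rw [collapseExponent_wlgsb]; norm_num⟩
  by_contra hne
  have h1 := lam_eq_one_of_isLocalExtr h hy hext hne
  norm_num at h1

end BoussinesqThetaFloor

end Summit.NavierStokesRegularity.OSWSelfSimilar
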